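import Summits.NavierStokesRegularity.NavierStokesRegularity.Theorems.HubbleDynamoNoSelfExcitedDynamoReduction
import Literature.Analysis.FluidPDE.KNSSThm53OfWindow
import HarnessLib

/-!
# Crux `NoSelfExcitedDynamo` (stmt-NavierStokesRegularity-1934), line `registered`: the axisymmetric
  (Cowling) rung is a theorem

Theorems file (lands `--supports stmt-NavierStokesRegularity-1934`; registered sub-goal
`stub_axisymmetricRung`). The route's dictionary reads Koch–Nadirashvili–Seregin–Šverák's Theorem 5.3
as the Cowling anti-dynamo theorem of the crux (`Γ = r u_θ` is a flux function); in the tree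
Theorem 5.3 is PROVED in the duality form (`knss_bound_C_over_r_holds`, KNSS 2009, Thm 5.3: a bounded
ancient mild solution, `ν = 1`, with measurable axisymmetric slices and `r‖u(t,x)‖ ≤ C` vanishes a.e.
on every slice). Since the pointwise Type-I bound `‖u‖ ≤ C/(‖x‖ + √(−t))` gives `r‖u‖ ≤ C`
(`reduction_cylRadius_mul_norm_le`), the crux HOLDS for axisymmetric fields, for every Type-I constant.
-/

noncomputable section

-- the mandated stub namespace repeats `NavierStokesRegularity` (tree precedent for this crux's stubs)
set_option linter.dupNamespace false

namespace Summit.NavierStokesRegularity.NavierStokesRegularity.Theorems.NoSelfExcitedDynamo.Registered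

open Set MeasureTheory Filter Topology
open Literature.Analysis.FluidPDE

/-- **The axisymmetric rung of the crux** (registered sub-goal `stub_axisymmetricRung`; KNSS 2009,
Thm 5.3 = the Cowling anti-dynamo theorem of the route's dictionary): every bounded ancient mild
solution of Navier–Stokes (`ν = 1`, duality form) on `ℝ³ × (−∞, 0)` with measurable AXISYMMETRIC
slices and the pointwise Type-I bound `‖u(t, x)‖ ≤ C / (‖x‖ + √(−t))` (any `C`) has a.e.-zero slices.
Proof: `r ≤ ‖x‖ ≤ ‖x‖ + √(−t)` turns the Type-I bound into KNSS's `r‖u‖ ≤ C`, and the tree's proved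
duality-form Theorem 5.3 (`knss_bound_C_over_r_holds`) applies. -/
theorem stub_axisymmetricRung :
    ∀ u : ℝ → EuclideanSpace ℝ (Fin 3) → EuclideanSpace ℝ (Fin 3),
      IsBoundedAncientMildSolution 1 u →
      (∀ t < 0, AEStronglyMeasurable (u t) volume) → (∀ t < 0, IsAxisymmetric (u t)) →
      (∃ C : ℝ, HasTypeIDecay C u) →
      ∀ t < 0, u t =ᵐ[volume] (0 : EuclideanSpace ℝ (Fin 3) → EuclideanSpace ℝ (Fin 3)) := by
  intro u hu hmeas haxi hdec
  obtain ⟨C, hC⟩ := hdec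
  exact knss_bound_C_over_r_holds hu hmeas haxi ⟨C, reduction_cylRadius_mul_norm_le hC⟩

end Summit.NavierStokesRegularity.NavierStokesRegularity.Theorems.NoSelfExcitedDynamo.Registered

end
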